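import Summits.SmoothPoincare4.SmoothPoincare4.Theorems.SymplecticOrigamiOrigamiFoldExistenceStubCleanOnePleatIroningRadial
import Literature.Topology.FourManifolds.FrameSignsAlongPaths
import Mathlib.Analysis.Calculus.InverseFunctionTheorem.FDeriv
import Mathlib.LinearAlgebra.Matrix.Block
import Mathlib.Analysis.Normed.Module.Connected

/-!
# Stub `stub_cleanOnePleatIroning` of line `shadow-pleats` for crux `OrigamiFoldExistence` — X:
# the SIDE of the crease on which the chart collar lies (item stmt-SmoothPoincare4-7844, route SymplecticOrigami; seat c3, S5a worker, wave 2)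

Tenth helper file for the registered stub `stub_cleanOnePleatIroning` (S5a): step (T1) of its
remaining ingredient `CleanPleatIroningChart` (file III), in the chart-local form the smooth
half needs.  SETTING (abstract; no manifold): two smooth maps `G, Λ₀ : ℝ⁴ → ℝ⁴` agreeing on
the sphere `S_R` (`Λ₀ = G` on `|u| = R`), `Λ₀` immersive on a larger open ball `B_{R'}` (so
`U := Λ₀(B_R)` is an open region with `closure U ⊆ U ∪ Λ₀(S_R)`), `G` injective on the
half-closed shell `{R - η₀ < |u| ≤ R}`, and — the ORIENTATION HYPOTHESIS supplied by files
VII–IX — `det dΛ₀ · det dG > 0` at the one point `R e₀` of the sphere.  CONCLUSION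
(`image_innerShell_subset`, registered sub-goal): **the inner shell is mapped by `G` INTO the
filled region, `G {R - η₀ < |u| < R} ⊆ Λ₀(B_R)`.**

Proof.  `G` of the (preconnected) open inner shell misses the crease `G(S_R) = Λ₀(S_R)`
(injectivity), hence lies in `U` or in `(closure U)ᶜ`.  In the second case read `G` near
`u₀ = R e₀` through the local inverse of `Λ₀` (inverse function theorem): `Φ = Λ₀⁻¹ ∘ G` fixes
the sphere near `u₀`, so `dΦ(u₀)` is the identity on `e₀ᗮ` (great circles) and
`det dΦ(u₀) = ⟪e₀, dΦ(u₀) e₀⟫` (a triangular matrix); the points `(R - t) e₀` of the inner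
shell would be mapped OUTSIDE the closed ball (their `G`-images avoid `closure U`), so
`t ↦ |Φ((R + t) e₀)|²` is `≥ R²` for small `t < 0`, forcing `⟪e₀, dΦ(u₀) e₀⟫ ≤ 0`; but
`det dΦ(u₀) = det dG(u₀) / det dΛ₀(u₀) > 0` — contradiction.

Lemmas: `det_eq_apply_zero_of_fix` (an endomorphism of `ℝ⁴` fixing `e₀ᗮ` has determinant
`⟪e₀, T e₀⟫`), `fderiv_apply_eq_self_of_sphere_fix`, `deriv_nonpos_of_eventually_ge`
(one-sided derivative test), `isOpen_image_of_injective_fderiv`; the orientation hypothesis is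
an INPUT here, supplied by files VII–IX in the final assembly.
Sources: M. W. Hirsch, *Differential Topology* (1976), Ch. 4 §4 (induced boundary
orientation); the S5a roadmap in file III.
-/

noncomputable section

-- the prescribed namespace `Summit.<P>.<Sub>.…` duplicates `SmoothPoincare4` (P = Sub)
set_option linter.dupNamespace false

open scoped Manifold ContDiff Topology RealInnerProductSpace
open Set Function Filter Metric Module

namespace Summit.SmoothPoincare4.SmoothPoincare4.Theorems.OrigamiFoldExistence.ShadowPleats

/-! ### Linear algebra: endomorphisms fixing the hyperplane `e₀ᗮ` -/

section LinAlg

/-- **An endomorphism of `ℝ⁴` fixing the coordinate hyperplane `{w 0 = 0}` pointwise has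
determinant `(T e₀) 0 = ⟪e₀, T e₀⟫`** (its matrix in the standard basis is lower triangular
with diagonal `((T e₀) 0, 1, 1, 1)`). [folklore] -/
theorem det_eq_apply_zero_of_fix
    {T : EuclideanSpace ℝ (Fin 4) →L[ℝ] EuclideanSpace ℝ (Fin 4)}
    (hT : ∀ w : EuclideanSpace ℝ (Fin 4), w 0 = 0 → T w = w) :
    T.det = (T (EuclideanSpace.single (0 : Fin 4) (1 : ℝ))) 0 := by
  set b : Basis (Fin 4) ℝ (EuclideanSpace ℝ (Fin 4)) := PiLp.basisFun 2 ℝ (Fin 4) with hb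
  change LinearMap.det (T : EuclideanSpace ℝ (Fin 4) →ₗ[ℝ] EuclideanSpace ℝ (Fin 4)) = _
  rw [← LinearMap.det_toMatrix b]
  have hM : ∀ i j : Fin 4,
      LinearMap.toMatrix b b (T : EuclideanSpace ℝ (Fin 4) →ₗ[ℝ] EuclideanSpace ℝ (Fin 4)) i j =
        if j = 0 then (T (EuclideanSpace.single (0 : Fin 4) (1 : ℝ))) i
        else if i = j then 1 else 0 := by
    intro i j
    rw [LinearMap.toMatrix_apply, hb, PiLp.basisFun_repr, ContinuousLinearMap.coe_coe,
      PiLp.basisFun_apply]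
    by_cases hj : j = 0
    · subst hj
      simp
    · rw [if_neg hj, hT _ (by simp [Ne.symm hj]), PiLp.single_apply]
  have htri : (LinearMap.toMatrix b b
      (T : EuclideanSpace ℝ (Fin 4) →ₗ[ℝ] EuclideanSpace ℝ (Fin 4))).BlockTriangular
        OrderDual.toDual := by
    intro i j hij
    have hij' : i < j := OrderDual.toDual_lt_toDual.1 hij
    have hj0 : j ≠ 0 := by
      rintro rfl
      exact (Fin.not_lt_zero i) hij'
    rw [hM, if_neg hj0, if_neg hij'.ne]
  rw [Matrix.det_of_lowerTriangular _ htri, Fin.prod_univ_four, hM, hM, hM, hM]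
  simp

end LinAlg

/-! ### Calculus lemmas -/

section Calculus

/-- **A map fixing a round sphere near a point has tangentially trivial derivative there**:
if `Φ u = u` for all `u` near `u₀ ≠ 0` with `|u| = |u₀|`, then `dΦ(u₀) w = w` for every
`w ⊥ u₀` (differentiate along the great circle through `u₀` with velocity `w`). [folklore] -/
theorem fderiv_apply_eq_self_of_sphere_fix
    {Φ : EuclideanSpace ℝ (Fin 4) → EuclideanSpace ℝ (Fin 4)} {u₀ : EuclideanSpace ℝ (Fin 4)}
    (hu₀ : u₀ ≠ 0) (hΦd : DifferentiableAt ℝ Φ u₀)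
    (hfix : ∀ᶠ u in 𝓝 u₀, ‖u‖ = ‖u₀‖ → Φ u = u) {w : EuclideanSpace ℝ (Fin 4)}
    (hw : ⟪u₀, w⟫ = 0) : fderiv ℝ Φ u₀ w = w := by
  by_cases hw0 : w = 0
  · rw [hw0, map_zero]
  have hupos : 0 < ‖u₀‖ := norm_pos_iff.2 hu₀
  have hwpos : 0 < ‖w‖ := norm_pos_iff.2 hw0
  -- the great circle through `u₀` with velocity `w` (as in file IV)
  set a : ℝ := ‖w‖ / ‖u₀‖ with ha
  set b : ℝ := ‖u₀‖ / ‖w‖ with hb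
  have hba : b * a = 1 := by rw [ha, hb]; field_simp
  set γ : ℝ → EuclideanSpace ℝ (Fin 4) :=
    fun t => Real.cos (a * t) • u₀ + (b * Real.sin (a * t)) • w with hγ
  have hγ0 : γ 0 = u₀ := by simp [hγ]
  have hγnorm : ∀ t, ‖γ t‖ = ‖u₀‖ := by
    intro t
    have hsq : ‖γ t‖ ^ 2 = ‖u₀‖ ^ 2 := by
      have h1 : ‖γ t‖ ^ 2 = ‖Real.cos (a * t) • u₀‖ ^ 2 +
          2 * ⟪Real.cos (a * t) • u₀, (b * Real.sin (a * t)) • w⟫ +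
          ‖(b * Real.sin (a * t)) • w‖ ^ 2 := by
        rw [hγ]
        exact norm_add_sq_real _ _
      rw [h1, real_inner_smul_left, real_inner_smul_right, hw, mul_zero, mul_zero, mul_zero,
        add_zero, norm_smul, norm_smul, mul_pow, mul_pow, Real.norm_eq_abs, Real.norm_eq_abs,
        sq_abs, sq_abs, hb, mul_pow, div_pow]
      have hv2 : ‖w‖ ^ 2 ≠ 0 := by positivity
      field_simp
      nlinarith [Real.cos_sq_add_sin_sq (a * t)]
    exact (sq_eq_sq₀ (norm_nonneg _) (norm_nonneg _)).1 hsq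
  have hγderiv : HasDerivAt γ w 0 := by
    have hlin : HasDerivAt (fun t : ℝ => a * t) a 0 := by
      simpa using (hasDerivAt_id (0 : ℝ)).const_mul a
    have h1 : HasDerivAt (fun t : ℝ => Real.cos (a * t)) (-Real.sin (a * 0) * a) 0 :=
      (Real.hasDerivAt_cos (a * 0)).comp (0 : ℝ) hlin
    have h2 : HasDerivAt (fun t : ℝ => b * Real.sin (a * t)) (b * (Real.cos (a * 0) * a)) 0 :=
      ((Real.hasDerivAt_sin (a * 0)).comp (0 : ℝ) hlin).const_mul b
    have h3 := (h1.smul_const u₀).add (h2.smul_const w)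
    have heq : (-Real.sin (a * 0) * a) • u₀ + (b * (Real.cos (a * 0) * a)) • w = w := by
      simp only [mul_zero, Real.sin_zero, neg_zero, zero_mul, zero_smul, Real.cos_zero, one_mul,
        zero_add, hba, one_smul]
    rw [heq] at h3
    exact h3
  -- `Φ ∘ γ = γ` near `0`
  have hlim : Tendsto γ (𝓝 0) (𝓝 u₀) := by
    have := hγderiv.continuousAt.tendsto
    rwa [hγ0] at this
  have heq : (Φ ∘ γ) =ᶠ[𝓝 0] γ := by
    filter_upwards [hlim.eventually hfix] with t ht
    exact ht (hγnorm t)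
  -- differentiate both sides
  have hΦ' : HasFDerivAt Φ (fderiv ℝ Φ u₀) (γ 0) := by rw [hγ0]; exact hΦd.hasFDerivAt
  have h1 : HasDerivAt (Φ ∘ γ) (fderiv ℝ Φ u₀ w) 0 := hΦ'.comp_hasDerivAt (0 : ℝ) hγderiv
  have h2 : HasDerivAt (Φ ∘ γ) w 0 := hγderiv.congr_of_eventuallyEq heq
  exact h1.unique h2

/-- **One-sided first-derivative test**: if `f` is differentiable at `0` and `f 0 ≤ f t` for
all small `t < 0`, then `f' 0 ≤ 0`. [folklore] -/
theorem deriv_nonpos_of_eventually_ge {f : ℝ → ℝ} {f' : ℝ} (hf : HasDerivAt f f' 0)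
    (hge : ∀ᶠ t in 𝓝[<] (0 : ℝ), f 0 ≤ f t) : f' ≤ 0 := by
  have hslope := hf.tendsto_slope_zero_left
  refine le_of_tendsto hslope ?_
  filter_upwards [hge, self_mem_nhdsWithin] with t ht ht0
  rw [zero_add]
  have h1 : 0 ≤ f t - f 0 := sub_nonneg.2 ht
  have h2 : t⁻¹ < 0 := inv_lt_zero.2 ht0
  rw [smul_eq_mul]
  nlinarith

variable {F : EuclideanSpace ℝ (Fin 4) → EuclideanSpace ℝ (Fin 4)}

/-- A `C^∞` self-map of `ℝ⁴` with injective differential at `x` is strictly differentiable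
there with an INVERTIBLE derivative (the input format of Mathlib's inverse function theorem). -/
theorem exists_hasStrictFDerivAt_equiv (hF : ContDiff ℝ ∞ F) (x : EuclideanSpace ℝ (Fin 4))
    (h : Injective (fderiv ℝ F x)) :
    ∃ L : EuclideanSpace ℝ (Fin 4) ≃L[ℝ] EuclideanSpace ℝ (Fin 4),
      (L : EuclideanSpace ℝ (Fin 4) →L[ℝ] EuclideanSpace ℝ (Fin 4)) = fderiv ℝ F x ∧
      HasStrictFDerivAt F (L : EuclideanSpace ℝ (Fin 4) →L[ℝ] EuclideanSpace ℝ (Fin 4)) x := by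
  refine ⟨(fderiv ℝ F x).toContinuousLinearEquivOfDetNeZero
    (Literature.Topology.FourManifolds.det_ne_zero_of_injective h), ?_, ?_⟩
  · exact ContinuousLinearMap.coe_toContinuousLinearEquivOfDetNeZero _ _
  · rw [ContinuousLinearMap.coe_toContinuousLinearEquivOfDetNeZero]
    exact hF.contDiffAt.hasStrictFDerivAt (by simp)

/-- **Immersive smooth self-maps of `ℝ⁴` are open on open sets** (inverse function theorem).
[folklore] -/
theorem isOpen_image_of_injective_fderiv (hF : ContDiff ℝ ∞ F) {V : Set (EuclideanSpace ℝ (Fin 4))}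
    (hV : IsOpen V) (hinj : ∀ x ∈ V, Injective (fderiv ℝ F x)) : IsOpen (F '' V) := by
  rw [isOpen_iff_mem_nhds]
  rintro y ⟨x, hx, rfl⟩
  obtain ⟨L, -, hL⟩ := exists_hasStrictFDerivAt_equiv hF x (hinj x hx)
  rw [← hL.map_nhds_eq_of_equiv]
  exact image_mem_map (hV.mem_nhds hx)

end Calculus

/-! ### The side determination -/

section Side

variable {G Λ₀ : EuclideanSpace ℝ (Fin 4) → EuclideanSpace ℝ (Fin 4)}

/-- **The chart collar enters the filled region (step (T1) of `CleanPleatIroningChart`).**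
Let `G, Λ₀ : ℝ⁴ → ℝ⁴` be smooth, `Λ₀ = G` on the sphere `|u| = R` (`R > 0`), `Λ₀` immersive
on a larger open ball `B_{R'}`, `G` injective on the half-closed shell `{R - η₀ < |u| ≤ R}`,
and suppose `det dΛ₀ · det dG > 0` at the point `R e₀`.  Then `G` maps the open inner shell
`{R - η₀ < |u| < R}` into the filled region `Λ₀(B_R)`.  [Proof: the image of the shell is
preconnected and misses the crease `Λ₀(S_R) ⊇ ∂ Λ₀(B_R)`, so it lies inside or outside; if
outside, `Φ = Λ₀⁻¹ ∘ G` near `R e₀` fixes the sphere, has `dΦ = id` on `e₀ᗮ` and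
`det dΦ = ⟪e₀, dΦ e₀⟫ > 0`, yet pushes the points `(R - t) e₀` out of the closed ball, whence
`⟪e₀, dΦ e₀⟫ ≤ 0` by the one-sided derivative test — contradiction.] [folklore] -/
theorem image_innerShell_subset (hG : ContDiff ℝ ∞ G) (hΛ : ContDiff ℝ ∞ Λ₀) {R R' η₀ : ℝ}
    (hR : 0 < R) (hRR' : R < R') (hη₀ : 0 < η₀) (hη₀R : η₀ < R)
    (hΛimm : ∀ u ∈ ball (0 : EuclideanSpace ℝ (Fin 4)) R', Injective (fderiv ℝ Λ₀ u))
    (hagree : ∀ u : EuclideanSpace ℝ (Fin 4), ‖u‖ = R → Λ₀ u = G u)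
    (hGinj : InjOn G {u : EuclideanSpace ℝ (Fin 4) | R - η₀ < ‖u‖ ∧ ‖u‖ ≤ R})
    (hsign : 0 < (fderiv ℝ Λ₀ (R • EuclideanSpace.single (0 : Fin 4) (1 : ℝ))).det *
      (fderiv ℝ G (R • EuclideanSpace.single (0 : Fin 4) (1 : ℝ))).det) :
    G '' {u : EuclideanSpace ℝ (Fin 4) | R - η₀ < ‖u‖ ∧ ‖u‖ < R} ⊆ Λ₀ '' ball 0 R := by
  set S : Set (EuclideanSpace ℝ (Fin 4)) := {u | R - η₀ < ‖u‖ ∧ ‖u‖ < R} with hS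
  set U : Set (EuclideanSpace ℝ (Fin 4)) := Λ₀ '' ball 0 R with hU
  set e0 : EuclideanSpace ℝ (Fin 4) := EuclideanSpace.single (0 : Fin 4) (1 : ℝ) with he0
  set u₀ : EuclideanSpace ℝ (Fin 4) := R • e0 with hu₀
  -- `U` is open, and its closure adds at most the crease `Λ₀(S_R)`
  have hUopen : IsOpen U :=
    isOpen_image_of_injective_fderiv hΛ isOpen_ball fun x hx => hΛimm x (ball_subset_ball hRR'.le hx)
  have hcl : closure U ⊆ U ∪ Λ₀ '' sphere 0 R := by
    have h1 : closure U ⊆ Λ₀ '' closedBall 0 R :=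
      closure_minimal (image_mono ball_subset_closedBall)
        ((isCompact_closedBall (0 : EuclideanSpace ℝ (Fin 4)) R).image hΛ.continuous).isClosed
    intro y hy
    obtain ⟨x, hx, rfl⟩ := h1 hy
    rcases (mem_closedBall_zero_iff.1 hx).lt_or_eq with h | h
    · exact Or.inl ⟨x, mem_ball_zero_iff.2 h, rfl⟩
    · exact Or.inr ⟨x, mem_sphere_zero_iff_norm.2 h, rfl⟩
  -- `G(S)` misses the crease
  have hmiss : ∀ u ∈ S, G u ∉ Λ₀ '' sphere (0 : EuclideanSpace ℝ (Fin 4)) R := by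
    rintro u hu ⟨x, hx, hxu⟩
    have hxR : ‖x‖ = R := mem_sphere_zero_iff_norm.1 hx
    rw [hagree x hxR] at hxu
    have := hGinj ⟨by rw [hxR]; linarith, hxR.le⟩ ⟨hu.1, hu.2.le⟩ hxu
    rw [← this] at hu
    exact hu.2.ne hxR
  -- dichotomy: `G(S)` is preconnected, inside `U ∪ (closure U)ᶜ`
  have hpre : IsPreconnected (G '' S) := by
    -- the open shell is the image of `sphere × (R - η₀, R)` under `(x, r) ↦ r • x`
    have hS' : S = (fun p : EuclideanSpace ℝ (Fin 4) × ℝ => p.2 • p.1) ''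
        (sphere (0 : EuclideanSpace ℝ (Fin 4)) 1 ×ˢ Ioo (R - η₀) R) := by
      ext x
      simp only [hS, mem_setOf_eq, mem_image, mem_prod, mem_sphere_zero_iff_norm, mem_Ioo, Prod.exists]
      refine ⟨fun ⟨ha', hb'⟩ => ⟨‖x‖⁻¹ • x, ‖x‖, ⟨?_, ha', hb'⟩, ?_⟩, ?_⟩
      · rw [norm_smul, norm_inv, norm_norm, inv_mul_cancel₀ (by linarith : (0 : ℝ) < ‖x‖).ne']
      · rw [smul_smul, mul_inv_cancel₀ (by linarith : (0 : ℝ) < ‖x‖).ne', one_smul]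
      · rintro ⟨y, r, ⟨hy, har, hrb⟩, rfl⟩
        rw [norm_smul, Real.norm_of_nonneg (by linarith : (0 : ℝ) ≤ r), hy, mul_one]
        exact ⟨har, hrb⟩
    have hE : 1 < Module.rank ℝ (EuclideanSpace ℝ (Fin 4)) :=
      Module.one_lt_rank_of_one_lt_finrank (by rw [finrank_euclideanSpace_fin]; norm_num)
    have hSpre : IsPreconnected S := by
      rw [hS']
      exact ((isPreconnected_sphere hE 0 1).prod isPreconnected_Ioo).image _
        (continuous_snd.smul continuous_fst).continuousOn
    exact hSpre.image G hG.continuous.continuousOn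
  have hsub : G '' S ⊆ U ∪ (closure U)ᶜ := by
    rintro y ⟨u, hu, rfl⟩
    by_cases h : G u ∈ closure U
    · rcases hcl h with h' | h'
      · exact Or.inl h'
      · exact absurd h' (hmiss u hu)
    · exact Or.inr h
  rcases hpre.subset_or_subset hUopen isClosed_closure.isOpen_compl
    (disjoint_compl_right.mono_left subset_closure) hsub with hgood | hbad
  · exact hgood
  -- THE BAD CASE `G(S) ⊆ (closure U)ᶜ` is contradictory
  exfalso
  have hbad' : ∀ u ∈ S, G u ∉ closure U := fun u hu => hbad ⟨u, hu, rfl⟩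
  have he0norm : ‖e0‖ = 1 := by rw [he0, PiLp.norm_single, norm_one]
  have hu₀norm : ‖u₀‖ = R := by rw [hu₀, norm_smul, he0norm, mul_one, Real.norm_of_nonneg hR.le]
  have hu₀ne : u₀ ≠ 0 := by
    rw [← norm_ne_zero_iff, hu₀norm]; exact hR.ne'
  have hu₀ball : u₀ ∈ ball (0 : EuclideanSpace ℝ (Fin 4)) R' := by
    rw [mem_ball_zero_iff, hu₀norm]; exact hRR'
  -- the local inverse `Ψ` of `Λ₀` at `u₀` and `Φ = Ψ ∘ G`
  obtain ⟨L, hL, hΛs⟩ := exists_hasStrictFDerivAt_equiv hΛ u₀ (hΛimm u₀ hu₀ball)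
  set Ψ := hΛs.localInverse Λ₀ L u₀ with hΨ
  obtain ⟨Φ, hΦ⟩ : ∃ Φ : EuclideanSpace ℝ (Fin 4) → EuclideanSpace ℝ (Fin 4), Φ = Ψ ∘ G := ⟨_, rfl⟩
  have hGu₀ : G u₀ = Λ₀ u₀ := (hagree u₀ hu₀norm).symm
  have hright : ∀ᶠ u in 𝓝 u₀, Λ₀ (Φ u) = G u := by
    have hGc : Tendsto G (𝓝 u₀) (𝓝 (Λ₀ u₀)) := by
      rw [← hGu₀]; exact hG.continuous.continuousAt
    rw [hΦ]
    exact hGc.eventually hΛs.eventually_right_inverse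
  have hfix : ∀ᶠ u in 𝓝 u₀, ‖u‖ = ‖u₀‖ → Φ u = u := by
    rw [hΦ]
    filter_upwards [hΛs.eventually_left_inverse] with u hu hnorm
    show Ψ (G u) = u
    rw [← hagree u (by rw [hnorm, hu₀norm])]
    exact hu
  have hΦu₀ : Φ u₀ = u₀ := by
    rw [hΦ]
    show Ψ (G u₀) = u₀
    rw [hGu₀]
    exact hΛs.localInverse_apply_image
  -- the differential `T = dΛ₀(u₀)⁻¹ ∘ dG(u₀)` of `Φ` at `u₀`
  have hΨd : HasFDerivAt Ψ (L.symm : EuclideanSpace ℝ (Fin 4) →L[ℝ] EuclideanSpace ℝ (Fin 4)) (G u₀) := by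
    rw [hGu₀]; exact hΛs.to_localInverse.hasFDerivAt
  have hGd : HasFDerivAt G (fderiv ℝ G u₀) u₀ := (hG.differentiable (by simp) u₀).hasFDerivAt
  have hΦd : HasFDerivAt Φ ((L.symm : EuclideanSpace ℝ (Fin 4) →L[ℝ] EuclideanSpace ℝ (Fin 4)).comp
      (fderiv ℝ G u₀)) u₀ := by
    rw [hΦ]
    exact hΨd.comp u₀ hGd
  set T := (L.symm : EuclideanSpace ℝ (Fin 4) →L[ℝ] EuclideanSpace ℝ (Fin 4)).comp (fderiv ℝ G u₀)
    with hT
  have hfd : fderiv ℝ Φ u₀ = T := hΦd.fderiv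
  -- `T` is the identity on `e₀ᗮ`, so `det T = (T e₀) 0`
  have htan : ∀ w : EuclideanSpace ℝ (Fin 4), w 0 = 0 → T w = w := by
    intro w hw0
    rw [← hfd]
    refine fderiv_apply_eq_self_of_sphere_fix hu₀ne hΦd.differentiableAt hfix ?_
    rw [hu₀, real_inner_smul_left, he0, EuclideanSpace.inner_single_left, hw0]
    simp
  have hdetT : T.det = (T e0) 0 := det_eq_apply_zero_of_fix htan
  -- `det T > 0`
  have hdetpos : 0 < T.det := by
    have h1 : T.det = (L.symm : EuclideanSpace ℝ (Fin 4) →L[ℝ] EuclideanSpace ℝ (Fin 4)).det *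
        (fderiv ℝ G u₀).det := by
      rw [hT]
      show LinearMap.det (((L.symm : EuclideanSpace ℝ (Fin 4) →L[ℝ] EuclideanSpace ℝ (Fin 4)) :
          EuclideanSpace ℝ (Fin 4) →ₗ[ℝ] EuclideanSpace ℝ (Fin 4)).comp
        ((fderiv ℝ G u₀ : EuclideanSpace ℝ (Fin 4) →L[ℝ] EuclideanSpace ℝ (Fin 4)) :
          EuclideanSpace ℝ (Fin 4) →ₗ[ℝ] EuclideanSpace ℝ (Fin 4))) = _
      exact LinearMap.det_comp _ _
    have h2 : (L.symm : EuclideanSpace ℝ (Fin 4) →L[ℝ] EuclideanSpace ℝ (Fin 4)).det *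
        (fderiv ℝ Λ₀ u₀).det = 1 := by
      rw [← hL]
      show LinearMap.det _ * LinearMap.det _ = 1
      rw [← LinearMap.det_comp]
      have hid : ((L.symm : EuclideanSpace ℝ (Fin 4) →L[ℝ] EuclideanSpace ℝ (Fin 4)) :
            EuclideanSpace ℝ (Fin 4) →ₗ[ℝ] EuclideanSpace ℝ (Fin 4)).comp
          ((L : EuclideanSpace ℝ (Fin 4) →L[ℝ] EuclideanSpace ℝ (Fin 4)) :
            EuclideanSpace ℝ (Fin 4) →ₗ[ℝ] EuclideanSpace ℝ (Fin 4)) = LinearMap.id := by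
        ext x
        simp
      rw [hid, LinearMap.det_id]
    have h3 : T.det * (fderiv ℝ Λ₀ u₀).det = (fderiv ℝ G u₀).det := by
      rw [h1]
      calc _ = (fderiv ℝ G u₀).det * ((L.symm : EuclideanSpace ℝ (Fin 4) →L[ℝ]
          EuclideanSpace ℝ (Fin 4)).det * (fderiv ℝ Λ₀ u₀).det) := by ring
        _ = _ := by rw [h2, mul_one]
    have h4 : 0 < T.det * (fderiv ℝ Λ₀ u₀).det * (fderiv ℝ Λ₀ u₀).det := by
      rw [h3, mul_comm]; exact hsign
    have h5 : 0 < (fderiv ℝ Λ₀ u₀).det * (fderiv ℝ Λ₀ u₀).det := by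
      have hne : (fderiv ℝ Λ₀ u₀).det ≠ 0 :=
        Literature.Topology.FourManifolds.det_ne_zero_of_injective (hΛimm u₀ hu₀ball)
      exact mul_self_pos.2 hne
    rw [mul_assoc] at h4
    exact (mul_pos_iff_of_pos_right h5).1 h4
  -- the one-sided test along `t ↦ (R + t) e₀` gives `(T e₀) 0 ≤ 0`
  have hline : HasDerivAt (fun t : ℝ => u₀ + t • e0) e0 0 := by
    simpa using ((hasDerivAt_id (0 : ℝ)).smul_const e0).const_add u₀
  have hΦ0 : HasFDerivAt Φ T (u₀ + (0 : ℝ) • e0) := by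
    rw [zero_smul, add_zero]; exact hΦd
  have hcomp : HasDerivAt (fun t : ℝ => Φ (u₀ + t • e0)) (T e0) 0 :=
    hΦ0.comp_hasDerivAt (0 : ℝ) hline
  have hfderiv : HasDerivAt (fun t : ℝ => ‖Φ (u₀ + t • e0)‖ ^ 2)
      (2 * ⟪Φ (u₀ + (0 : ℝ) • e0), T e0⟫) 0 := hcomp.norm_sq
  have hinner : ⟪Φ (u₀ + (0 : ℝ) • e0), T e0⟫ = R * (T e0) 0 := by
    rw [zero_smul, add_zero, hΦu₀, hu₀, real_inner_smul_left, he0, EuclideanSpace.inner_single_left]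
    simp
  rw [hinner] at hfderiv
  have hev : ∀ᶠ t in 𝓝[<] (0 : ℝ), ‖Φ (u₀ + (0 : ℝ) • e0)‖ ^ 2 ≤ ‖Φ (u₀ + t • e0)‖ ^ 2 := by
    -- along the line, `Λ₀ ∘ Φ = G` near `t = 0`
    have h1 : ∀ᶠ t in 𝓝 (0 : ℝ), Λ₀ (Φ (u₀ + t • e0)) = G (u₀ + t • e0) := by
      have hc : Tendsto (fun t : ℝ => u₀ + t • e0) (𝓝 0) (𝓝 u₀) := by
        have := hline.continuousAt.tendsto
        simpa using this
      exact hc.eventually hright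
    -- for `-η₀ < t < 0` the point `(R + t) e₀` lies in the inner shell
    have h2 : ∀ᶠ t in 𝓝[<] (0 : ℝ), u₀ + t • e0 ∈ S := by
      have hI : Ioo (-η₀) 0 ∈ 𝓝[<] (0 : ℝ) := Ioo_mem_nhdsLT (by linarith)
      filter_upwards [hI] with t ht
      have hnorm : ‖u₀ + t • e0‖ = R + t := by
        rw [hu₀, ← add_smul, norm_smul, he0norm, mul_one, Real.norm_of_nonneg (by linarith [ht.1, ht.2])]
      refine ⟨?_, ?_⟩
      · rw [hnorm]; linarith [ht.1]
      · rw [hnorm]; linarith [ht.2]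
    filter_upwards [mem_nhdsWithin_of_mem_nhds h1, h2] with t ht1 ht2
    rw [zero_smul, add_zero, hΦu₀, hu₀norm]
    -- `|Φ((R+t)e₀)| ≥ R`, for otherwise `G((R+t)e₀) ∈ U ⊆ closure U`
    have hge : R ≤ ‖Φ (u₀ + t • e0)‖ := by
      by_contra hlt
      have hlt' : ‖Φ (u₀ + t • e0)‖ < R := not_le.1 hlt
      have hmem : G (u₀ + t • e0) ∈ U := ⟨Φ (u₀ + t • e0), mem_ball_zero_iff.2 hlt', ht1⟩
      exact hbad' _ ht2 (subset_closure hmem)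
    exact pow_le_pow_left₀ hR.le hge 2
  have hle : 2 * (R * (T e0) 0) ≤ 0 := deriv_nonpos_of_eventually_ge hfderiv hev
  have hTe0 : (T e0) 0 ≤ 0 := by nlinarith
  rw [hdetT] at hdetpos
  exact absurd hTe0 (not_le.2 hdetpos)

end Side

end Summit.SmoothPoincare4.SmoothPoincare4.Theorems.OrigamiFoldExistence.ShadowPleats

end
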